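import Summits.HodgeConjecture.HodgeConjecture.Theorems.MarkmanPartnerTransportPartnerTransportEndomorphisms
import Summits.HodgeConjecture.HodgeConjecture.Theorems.MarkmanPartnerTransportK3Sq2TypeHodgeOfPicardThree
import Summits.HodgeConjecture.HodgeConjecture.Theorems.NikulinTwinTransportSquareGlueFree
import Literature.AlgebraicGeometry.HodgeTheory.ComplexOrientationFamily

/-!
# Route MarkmanPartnerTransport · the `E = ℚ` THIRD at Picard rank `≥ 4` — the Hodge conjecture for marked
# projective `K3^{[2]}`-type fourfolds whose transcendental Hodge endomorphisms are rational scalars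

The `k = 1, g₁ = id` instance of the support item `IsometrySpannedThird` (stmt-HodgeConjecture-19651),
restricted to `ρ(X) ≥ 4`, PROVED modulo the five named facts of `PartnerExistence` + `PartnerTransport`:

* `hodgeConjectureFor_of_hodgeEndomorphisms_scalar_of_four_le` — **for a marked smooth projective
  `K3^{[2]}`-type fourfold `X` with `ρ(X) ≥ 4` such that every rational Hodge endomorphism of `H²(X)`
  killing `N¹(X)` with `q`-transcendental image is a rational scalar on `T(X)` («`End_Hdg T(X) = ℚ`», the
  generic case), `HC⁴(X)` holds** — modulo {`Huybrechts_K3_periodSurjective_projective`,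
  `Beauville1983_hilbertSquare_markedIncidence`, `HilbertScheme.Beauville1983_hilbertSquare_blowupDiagonal_surjection`,
  `Markman2024_rationalHodgeIsometry_lift_algebraic_marked`, `Voisin2003_cupProduct_algebraicClasses`}.

Proof: `PartnerExistence` gives a K3 partner `(S, g)`; the `E = ℚ` clause descends to `S`
(`hodgeEndomorphisms_scalar_of_partner`); the tree's fact-free KERNEL THEOREM for K3 squares with
`End_Hdg T(S) = ℚ` (`SquareGlueFree.hodgeConjectureFor_square_of_hodgeEndomorphisms_scalar`) gives
`HC⁴(S × S)`; `PartnerTransport` concludes.  CONDITIONAL (credits nothing); print-implied combination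
(Markman 2024 + the `E = ℚ` K3-square theorem), not claimed as new mathematics.  No definition, no sorry.
Prover seat hodge-nonav-19652-p1 (gen 6), `--supports stmt-HodgeConjecture-19651`.

References: E. Markman, Compos. Math. 160 (2024) Thm. 1.1/1.4; Yu. Zarhin, J. reine angew. Math. 341
(1983) Thm. 1.5.1; D. Huybrechts, *Lectures on K3 Surfaces* Ch. 3, 6, 7; A. Beauville, J. Differential
Geom. 18 (1983) §6–9.
-/

noncomputable section

set_option linter.dupNamespace false

open Module CategoryTheory MonoidalCategory
open Literature.AlgebraicTopology.SingularHomology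
open Literature.AlgebraicGeometry Literature.AlgebraicGeometry.Motives Literature.AlgebraicGeometry.HodgeTheory
open Literature.AlgebraicGeometry.Hyperkaehler Literature.AlgebraicGeometry.Surfaces
open Literature.AlgebraicGeometry.HilbertScheme
open Summit.HodgeConjecture.HodgeConjecture.Theorems.NikulinTwinTransport

namespace Summit.HodgeConjecture.HodgeConjecture.Theorems.MarkmanPartnerTransport.PartnerLattice

/-- `MarkedK3Sq[X, φ, P, z]`: VERBATIM the `let MarkedK3Sq := …` binder of the route declarations of
MarkmanPartnerTransport (clauses (m1)–(m6)). Local notation only. -/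
local notation3 (prettyPrint := false) "MarkedK3Sq[" X ", " φ ", " P ", " z "]" =>
  (((IsIntegralClass P ∧ ∀ Q : complexBetti X (2 * 4), IsIntegralClass Q → ∃ n : ℤ, Q = n • P) ∧
    (∀ c : complexBetti X 2, IsIntegralClass c ↔ ∃ v : K3HilbertIndex → ℤ, φ c = fun i => (v i : ℂ)) ∧
    (∀ a : complexBetti X 2, cupPowTwo a 4 = ((3 : ℂ) * (k3HilbertForm 2 (φ a) (φ a)) ^ 2) • P) ∧
    (IsOfHodgeType 4 X 2 2 0 (LinearEquiv.symm φ z) ∧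
      ∀ τ : complexBetti X 2, IsOfHodgeType 4 X 2 2 0 τ → ∃ t : ℂ, τ = t • LinearEquiv.symm φ z) ∧
    (∀ c : complexBetti X 2, IsOfHodgeType 4 X 2 1 1 c ↔
      (k3HilbertForm 2 (φ c) z = 0 ∧ k3HilbertForm 2 (φ c) (star z) = 0)) ∧
    (k3HilbertForm 2 z z = 0 ∧ 0 < (k3HilbertForm 2 (star z) z).re)))

/-- **HC⁴ for marked projective `K3^{[2]}`-type fourfolds with `ρ(X) ≥ 4` and `End_Hdg T(X) = ℚ`**
(every rational Hodge endomorphism of `H²(X)` killing `N¹(X)` with `q`-transcendental image is a rational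
scalar on the `q`-transcendental classes), modulo five published named facts (module docstring).
[cite: Markman2024, §1.1 Thm. 1.1 and Thm. 1.4] [cite: Zarhin1983HodgeGroupsK3, Thm. 1.5.1]
[cite: Huybrechts2016K3, Ch. 6 Thm. 3.1 and Ch. 7 Thm. 4.1] -/
theorem hodgeConjectureFor_of_hodgeEndomorphisms_scalar_of_four_le
    (hP : Huybrechts_K3_periodSurjective_projective) (hB : Beauville1983_hilbertSquare_markedIncidence)
    (hρ : Beauville1983_hilbertSquare_blowupDiagonal_surjection)
    (hMk : Markman2024_rationalHodgeIsometry_lift_algebraic_marked)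
    (hcup : Voisin2003_cupProduct_algebraicClasses)
    {X : SchemeOver ℂ} (hX : IsSmoothProjective 4 X) (hK : IsOfK3HilbertSquareType X)
    {φ : complexBetti X 2 ≃ₗ[ℂ] (K3HilbertIndex → ℂ)} {P : complexBetti X (2 * 4)} {z : K3HilbertIndex → ℂ}
    (hM : MarkedK3Sq[X, φ, P, z]) (h4 : 4 ≤ Module.finrank ℂ (algebraicClasses X 1))
    (hQX : ∀ f : complexBetti X 2 →ₗ[ℂ] complexBetti X 2,
      (∀ y, IsRationalClass y → IsRationalClass (f y)) →
      (∀ (i j : ℕ) y, IsOfHodgeType 4 X 2 i j y → IsOfHodgeType 4 X 2 i j (f y)) →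
      (∀ d : complexBetti X 2, d ∈ algebraicClasses X 1 → f d = 0) →
      (∀ y : complexBetti X 2, ∀ d : complexBetti X 2, d ∈ algebraicClasses X 1 →
        k3HilbertForm 2 (φ (f y)) (φ d) = 0) →
      ∃ a : ℚ, ∀ y : complexBetti X 2,
        (∀ d : complexBetti X 2, d ∈ algebraicClasses X 1 → k3HilbertForm 2 (φ y) (φ d) = 0) →
        f y = (a : ℂ) • y) :
    HodgeConjectureFor 4 X := by
  refine hodgeConjectureFor_of_square_partner hP hB hρ hMk hcup hX hK hM h4 ?_
  intro S hS η p x g hSm hg _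
  obtain ⟨hp0, hmk, hxx, hxpos, hu⟩ := hSm
  have hμ := hasPoincareDuality_complexOrientationFamily
  obtain ⟨H, hH, Ξ, φH, PH, -, -, hMH, θ, hθ, hi⟩ := hB complexOrientationFamily hμ S hS η p x hmk hxx hxpos hu
  exact SquareGlueFree.hodgeConjectureFor_square_of_hodgeEndomorphisms_scalar hS.isSmoothProjective
    (hodgeEndomorphisms_scalar_of_partner hcup hμ hX hM hS hp0 hmk.2.2.1 hmk.2.2.2.1 hmk.2.2.2.2.1
      hmk.2.2.2.2.2 hxpos hH hMH hθ hi hg.1 hg.2.1 hg.2.2.2.2.1 hQX)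

end Summit.HodgeConjecture.HodgeConjecture.Theorems.MarkmanPartnerTransport.PartnerLattice

end
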